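import Mathlib

/-!
# Square incidence structures: "lines pairwise meet in one point" ⇒ projective plane (cell pub-namedobj, target M)
Framing: lottery ticket; floor = certified bounds/negative ranges.

**Lemma 1 of FAMILY-B1P.md, kernel-checked.** Let an incidence structure have `v = n² + n + 1` points and as
many lines, every line carrying exactly `n + 1` points, and any two distinct lines meeting in exactly one
point. Then every point lies on exactly `n + 1` lines and any two distinct points lie on exactly one common
line — i.e. the structure is a projective plane of order `n` (for `n ≥ 2`). This halves the work of
certifying an explicit plane (only line sizes and line–line intersections need checking; this is exactly what
`code/collin/build_plane.py` checks when it rebuilds the planes from the Case-A / Case-B normal forms), and it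
is the step that makes the two normal forms of `OrderElevenCollineation.lean` *equivalent* to planes.

Proof (double counting): with `r p` = number of lines through `p`, `∑ r = v (n+1)` (flags) and
`∑ r² = v (v + n)` (ordered line pairs through a point), hence `∑ (r − (n+1))² = v (v + n − (n+1)²) = 0`,
so `r ≡ n + 1`; then two distinct points lie on at most one common line (else two lines would share two
points), and the number of (ordered point pair, common line) incidences `∑_l (n+1) n = v (v − 1)` equals the
number of ordered point pairs, forcing exactly one common line each. Everything is stated for an abstract
decidable relation `mem : P → L → Prop` between finite types.
-/

namespace Summit.Ventures.DiscreteObjects.PP12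

open Finset

section Counting

variable {P L : Type*} (mem : P → L → Prop) [DecidableRel mem]

/-- number of lines through the point `p` -/
def lineCount [Fintype L] (p : P) : ℕ := (univ.filter fun l => mem p l).card

/-- number of points on the line `l` -/
def pointCount [Fintype P] (l : L) : ℕ := (univ.filter fun p => mem p l).card

/-- number of common points of two lines -/
def meetCount [Fintype P] (l₁ l₂ : L) : ℕ := (univ.filter fun p => mem p l₁ ∧ mem p l₂).card

/-- number of common lines of two points -/
def joinCount [Fintype L] (p₁ p₂ : P) : ℕ := (univ.filter fun l => mem p₁ l ∧ mem p₂ l).card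

/-- A line meets itself in all its points. -/
theorem meetCount_self [Fintype P] (l : L) : meetCount mem l l = pointCount mem l := by
  simp [meetCount, pointCount, and_self]

/-- A point is joined to itself by all its lines. -/
theorem joinCount_self [Fintype L] (p : P) : joinCount mem p p = lineCount mem p := by
  simp [joinCount, lineCount, and_self]

variable [Fintype P] [Fintype L]

/-- Flag count both ways: `∑_p (lines through p) = ∑_l (points on l)`. -/
theorem sum_lineCount_eq_sum_pointCount : ∑ p, lineCount mem p = ∑ l, pointCount mem l := by
  simp only [lineCount, pointCount, Finset.card_filter]
  exact Finset.sum_comm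

/-- Ordered pairs of lines through a common point, counted by the point and by the pair:
`∑_p (lines through p)² = ∑_{l₁} ∑_{l₂} |l₁ ∩ l₂|`. -/
theorem sum_lineCount_sq : ∑ p, lineCount mem p ^ 2 = ∑ l₁, ∑ l₂, meetCount mem l₁ l₂ := by
  have h : ∀ p, lineCount mem p ^ 2 = ∑ l₁, ∑ l₂, (if mem p l₁ ∧ mem p l₂ then 1 else 0) := by
    intro p
    simp only [lineCount, Finset.card_filter, sq, Finset.sum_mul_sum]
    refine Finset.sum_congr rfl fun l₁ _ => Finset.sum_congr rfl fun l₂ _ => ?_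
    by_cases h1 : mem p l₁ <;> by_cases h2 : mem p l₂ <;> simp [h1, h2]
  simp only [h, meetCount, Finset.card_filter]
  rw [Finset.sum_comm]
  exact Finset.sum_congr rfl fun l₁ _ => Finset.sum_comm

/-- The dual count: `∑_l (points on l)² = ∑_{p₁} ∑_{p₂} (common lines of p₁, p₂)`. -/
theorem sum_pointCount_sq : ∑ l, pointCount mem l ^ 2 = ∑ p₁, ∑ p₂, joinCount mem p₁ p₂ := by
  have h : ∀ l, pointCount mem l ^ 2 = ∑ p₁, ∑ p₂, (if mem p₁ l ∧ mem p₂ l then 1 else 0) := by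
    intro l
    simp only [pointCount, Finset.card_filter, sq, Finset.sum_mul_sum]
    refine Finset.sum_congr rfl fun p₁ _ => Finset.sum_congr rfl fun p₂ _ => ?_
    by_cases h1 : mem p₁ l <;> by_cases h2 : mem p₂ l <;> simp [h1, h2]
  simp only [h, joinCount, Finset.card_filter]
  rw [Finset.sum_comm]
  exact Finset.sum_congr rfl fun p₁ _ => Finset.sum_comm

end Counting

section Plane

variable {P L : Type*} [Fintype P] [Fintype L] [DecidableEq P] [DecidableEq L]
  {mem : P → L → Prop} [DecidableRel mem] {n : ℕ}

omit [DecidableEq P] in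
/-- **Regularity.** `v = n² + n + 1` points and lines, lines of size `n + 1`, distinct lines meeting in
exactly one point ⇒ every point is on exactly `n + 1` lines. -/
theorem lineCount_eq (hP : Fintype.card P = n ^ 2 + n + 1) (hL : Fintype.card L = n ^ 2 + n + 1)
    (hline : ∀ l, pointCount mem l = n + 1)
    (hmeet : ∀ l₁ l₂, l₁ ≠ l₂ → meetCount mem l₁ l₂ = 1) (p : P) : lineCount mem p = n + 1 := by
  -- ∑ r = v (n+1)
  have h1 : ∑ p, lineCount mem p = (n ^ 2 + n + 1) * (n + 1) := by
    rw [sum_lineCount_eq_sum_pointCount, Finset.sum_congr rfl fun l _ => hline l, Finset.sum_const,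
      smul_eq_mul, Finset.card_univ, hL]
  -- ∑ r² = v (v + n)
  have h2 : ∑ p, lineCount mem p ^ 2 = (n ^ 2 + n + 1) * (n ^ 2 + n + 1 + n) := by
    rw [sum_lineCount_sq]
    have inner : ∀ l₁, ∑ l₂, meetCount mem l₁ l₂ = n ^ 2 + n + 1 + n := by
      intro l₁
      have : ∀ l₂, meetCount mem l₁ l₂ = 1 + (if l₁ = l₂ then n else 0) := by
        intro l₂
        by_cases h : l₁ = l₂
        · subst h; rw [meetCount_self, hline]; simp; omega
        · rw [hmeet l₁ l₂ h]; simp [h]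
      rw [Finset.sum_congr rfl fun l₂ _ => this l₂, Finset.sum_add_distrib, Finset.sum_const,
        Finset.sum_ite_eq, smul_eq_mul, Finset.card_univ, hL]
      simp
    rw [Finset.sum_congr rfl fun l₁ _ => inner l₁, Finset.sum_const, smul_eq_mul, Finset.card_univ, hL]
  -- pass to ℤ: ∑ (r − (n+1))² = 0
  have h3 : ∑ p, ((lineCount mem p : ℤ) - (n + 1)) ^ 2 = 0 := by
    have e1 : (∑ p, (lineCount mem p : ℤ)) = ((n : ℤ) ^ 2 + n + 1) * (n + 1) := by exact_mod_cast h1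
    have e2 : (∑ p, (lineCount mem p : ℤ) ^ 2) = ((n : ℤ) ^ 2 + n + 1) * (n ^ 2 + n + 1 + n) := by
      exact_mod_cast h2
    have hc : (Finset.univ : Finset P).card = n ^ 2 + n + 1 := by rw [Finset.card_univ, hP]
    have : ∑ p, ((lineCount mem p : ℤ) - (n + 1)) ^ 2
        = (∑ p, (lineCount mem p : ℤ) ^ 2) - 2 * (n + 1) * (∑ p, (lineCount mem p : ℤ))
          + (Finset.univ : Finset P).card * ((n : ℤ) + 1) ^ 2 := by
      rw [Finset.mul_sum, ← Finset.sum_sub_distrib]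
      rw [show ((Finset.univ : Finset P).card : ℤ) * ((n : ℤ) + 1) ^ 2
          = ∑ _p : P, ((n : ℤ) + 1) ^ 2 by rw [Finset.sum_const, nsmul_eq_mul]]
      rw [← Finset.sum_add_distrib]
      exact Finset.sum_congr rfl fun p _ => by ring
    rw [this, e1, e2, hc]; push_cast; ring
  have h4 := (Finset.sum_eq_zero_iff_of_nonneg (fun p _ => sq_nonneg ((lineCount mem p : ℤ) - (n + 1)))).mp h3
    p (Finset.mem_univ p)
  have : (lineCount mem p : ℤ) = n + 1 := by
    have := pow_eq_zero_iff (n := 2) (by norm_num) |>.mp h4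
    linarith
  exact_mod_cast this

omit [DecidableEq L] in
/-- Two distinct points lie on at most one common line when distinct lines meet in exactly one point. -/
theorem joinCount_le_one (hmeet : ∀ l₁ l₂, l₁ ≠ l₂ → meetCount mem l₁ l₂ = 1) {p₁ p₂ : P}
    (hp : p₁ ≠ p₂) : joinCount mem p₁ p₂ ≤ 1 := by
  by_contra hgt
  rw [not_le, joinCount, Finset.one_lt_card] at hgt
  obtain ⟨l₁, hl₁, l₂, hl₂, hne⟩ := hgt
  simp only [Finset.mem_filter, Finset.mem_univ, true_and] at hl₁ hl₂
  have h2 : 2 ≤ meetCount mem l₁ l₂ := by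
    rw [meetCount]
    have hsub : ({p₁, p₂} : Finset P) ⊆ univ.filter fun p => mem p l₁ ∧ mem p l₂ := by
      intro p hp'
      simp only [Finset.mem_insert, Finset.mem_singleton] at hp'
      rcases hp' with rfl | rfl <;> simp [hl₁, hl₂]
    calc 2 = ({p₁, p₂} : Finset P).card := by rw [Finset.card_pair hp]
      _ ≤ _ := Finset.card_le_card hsub
  have := hmeet l₁ l₂ hne
  omega

/-- **Lemma 1 (FAMILY-B1P).** `v = n² + n + 1` points and as many lines, lines of size `n + 1`, any two
distinct lines meeting in exactly one point ⇒ any two distinct points lie on exactly one common line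
(together with `lineCount_eq`: the structure is a projective plane of order `n` as soon as `n ≥ 2`). -/
theorem joinCount_eq_one (hP : Fintype.card P = n ^ 2 + n + 1) (hL : Fintype.card L = n ^ 2 + n + 1)
    (hline : ∀ l, pointCount mem l = n + 1)
    (hmeet : ∀ l₁ l₂, l₁ ≠ l₂ → meetCount mem l₁ l₂ = 1) {p₁ p₂ : P} (hp : p₁ ≠ p₂) :
    joinCount mem p₁ p₂ = 1 := by
  -- target values g and pointwise bound joinCount ≤ g
  set g : P → P → ℕ := fun q₁ q₂ => if q₁ = q₂ then n + 1 else 1 with hg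
  have hle : ∀ q₁ q₂, joinCount mem q₁ q₂ ≤ g q₁ q₂ := by
    intro q₁ q₂
    by_cases h : q₁ = q₂
    · subst h; simp only [hg, if_true, joinCount_self, lineCount_eq hP hL hline hmeet q₁]; exact le_rfl
    · simp only [hg, h, if_false]; exact joinCount_le_one hmeet h
  -- both double sums equal v (n+1)²
  have hsumf : ∑ q₁, ∑ q₂, joinCount mem q₁ q₂ = (n ^ 2 + n + 1) * (n + 1) ^ 2 := by
    rw [← sum_pointCount_sq, Finset.sum_congr rfl fun l _ => by rw [hline l], Finset.sum_const,
      smul_eq_mul, Finset.card_univ, hL]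
  have hsumg : ∑ q₁, ∑ q₂, g q₁ q₂ = (n ^ 2 + n + 1) * (n + 1) ^ 2 := by
    have inner : ∀ q₁, ∑ q₂, g q₁ q₂ = n ^ 2 + n + 1 + n := by
      intro q₁
      have : ∀ q₂, g q₁ q₂ = 1 + (if q₁ = q₂ then n else 0) := by
        intro q₂; by_cases h : q₁ = q₂ <;> simp [hg, h]; omega
      rw [Finset.sum_congr rfl fun q₂ _ => this q₂, Finset.sum_add_distrib, Finset.sum_const,
        Finset.sum_ite_eq, smul_eq_mul, Finset.card_univ, hP]
      simp
    rw [Finset.sum_congr rfl fun q₁ _ => inner q₁, Finset.sum_const, smul_eq_mul, Finset.card_univ, hP]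
    ring
  have heq : ∑ q₁, ∑ q₂, joinCount mem q₁ q₂ = ∑ q₁, ∑ q₂, g q₁ q₂ := by rw [hsumf, hsumg]
  have hout := (Finset.sum_eq_sum_iff_of_le (fun q₁ _ => Finset.sum_le_sum fun q₂ _ => hle q₁ q₂)).mp heq
  have hin := (Finset.sum_eq_sum_iff_of_le (fun q₂ _ => hle p₁ q₂)).mp (hout p₁ (Finset.mem_univ _))
    p₂ (Finset.mem_univ _)
  simpa [hg, hp] using hin

end Plane

end Summit.Ventures.DiscreteObjects.PP12
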